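import Literature.NumberTheory.Sieve.SmoothNumbersAPSegment
import HarnessLib

/-!
# Harper's minor-arc estimate, III: the counting inputs (Proposition 1 of Harper 2016)

Topic `Literature/NumberTheory/Sieve`; a PROVED tool file toward
`Literature.NumberTheory.DiophantineGeometry.XYZUpperHalf` ([Harper2016, Cor. 1]). Proposition 1
of op. cit. (§3) bounds the two arithmetic quantities produced by the Cauchy–Schwarz reduction:
`T_j(r) = max_b #{n₁, n₂ ≤ N smooth : n₁ − n₂ ≡ b (mod r)}` and the diagonal sums
`∑_{r ∣ n₁−n₂} min{2U, 1/(2|n₁−n₂||δ|)}`. We prove both at the reference scale `x` (so that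
`Ψ(x', y) ≤ C x'^α ζ̃` and the segment bound `card_smooth_segment_modEq_le` apply with the SAME
`α = α(x, y)`, `ζ̃ = ζ(α, y)/√φ₂(α, y)`):

* `card_pairs_modEq_le` — for `r y ≤ N ≤ x` and every integer `b`:
  `#{(n₁, n₂) ∈ S² : n₁ − n₂ ≡ b (mod r)} ≤ #S · C log y (N/r)^α y^{1−α} ζ̃`,
  `S = S(y) ∩ [1, N]` (printed: `T_j(q) ≪ Ψ(N, y)²q^{−α} log x`).
* `diagWeight U δ n₁ n₂ = min{2U, 1/(2|n₁−n₂||δ|)}` (`= 2U` if `n₁ = n₂` or `δ = 0`) and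
  `sum_diagWeight_le` — for `L = 2(1 + |δ| x)`, `8 N ≤ x`... precisely `N = x/U` with `U ≥ 8`,
  `r y L ≤ 2N`:
  `∑_{(n₁,n₂) ∈ S², r ∣ n₁−n₂} diagWeight ≤ C (1 + log L) U #S log y · y^{1−α} ζ̃ (N/(L r))^α`
  (printed: the two cases `|δ| ≤ 1/x`, `|δ| > 1/x` with dyadic ranges `2^i x/(2^j q L² y)`).

## References

* A. J. Harper, Compositio Math. 152 (2016) 1121–1158, §3, Proposition 1 and its proof
  [Harper2016].
-/

noncomputable section

open Finset Real

namespace Literature.NumberTheory.Sieve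

/-! ### Pairs in a residue class -/

/-- **Pairs of smooth numbers in a residue class** (Harper's `T_j(q)`): for `x ≥ x₀`,
`(log x)^4 ≤ y`, `log y ≤ (log x)^{1/6}`, `r ≥ 1`, `r y ≤ N ≤ x` and every integer `b`,
`#{(n₁, n₂) ∈ S² : n₁ − n₂ ≡ b (mod r)} ≤ #S · C log y (N/r)^α y^{1−α} ζ(α,y)/√φ₂(α,y)`,
`S = S(y) ∩ [1, N]`, `α = α(x, y)`. [cite: Harper2016, §3, Proposition 1 (first bound) and its proof] -/
theorem card_pairs_modEq_le :
    ∃ C x₀ : ℝ, 0 < C ∧ ∀ (x : ℝ) (y : ℕ), x₀ ≤ x → Real.log x ^ 4 ≤ y →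
      Real.log y ≤ Real.log x ^ (1 / 6 : ℝ) → ∀ (r : ℕ), 0 < r → ∀ (N : ℝ), (r : ℝ) * y ≤ N → N ≤ x →
      ∀ b : ℤ,
        ((((Nat.smoothNumbersUpTo ⌊N⌋₊ (y + 1)) ×ˢ (Nat.smoothNumbersUpTo ⌊N⌋₊ (y + 1))).filter
            (fun nn => ((nn.1 : ℤ) - nn.2) % r = b % r)).card : ℝ) ≤
          (Nat.smoothNumbersUpTo ⌊N⌋₊ (y + 1)).card *
            (C * Real.log y * (N / r) ^ saddlePoint x y * (y : ℝ) ^ (1 - saddlePoint x y) *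
              (smoothZeta (saddlePoint x y) y / Real.sqrt (saddlePhi₂ (saddlePoint x y) y))) := by
  classical
  obtain ⟨C, x₀, hC, hseg⟩ := card_smooth_segment_modEq_le
  refine ⟨C, x₀, hC, fun x y hx hy4 hy6 r hr N hN hNx b => ?_⟩
  set S := Nat.smoothNumbersUpTo ⌊N⌋₊ (y + 1) with hS
  set Bd := C * Real.log y * (N / r) ^ saddlePoint x y * (y : ℝ) ^ (1 - saddlePoint x y) *
    (smoothZeta (saddlePoint x y) y / Real.sqrt (saddlePhi₂ (saddlePoint x y) y)) with hBd
  have hN0 : 0 ≤ N := le_trans (by positivity) hN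
  set F := (S ×ˢ S).filter (fun nn => ((nn.1 : ℤ) - nn.2) % r = b % r) with hF
  have hmaps : ∀ nn ∈ F, nn.2 ∈ S := by
    intro nn hnn
    rw [hF, Finset.mem_filter, Finset.mem_product] at hnn
    exact hnn.1.2
  rw [Finset.card_eq_sum_card_fiberwise hmaps]
  push_cast
  have hrow : ∀ n₂ ∈ S, ((F.filter (fun nn => nn.2 = n₂)).card : ℝ) ≤ Bd := by
    intro n₂ _
    -- the class of `n₁` is `c = (n₂ + b) mod r`
    set c : ℕ := (((n₂ : ℤ) + b) % r).toNat with hc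
    have hcz : (c : ℤ) = ((n₂ : ℤ) + b) % r := by
      rw [hc]; exact Int.toNat_of_nonneg (Int.emod_nonneg _ (by exact_mod_cast hr.ne'))
    have hcard := hseg x y hx hy4 hy6 r hr c 0 N le_rfl hN (by linarith)
    refine le_trans ?_ hcard
    have hinj := Finset.card_le_card_of_injOn (fun nn : ℕ × ℕ => nn.1)
      (s := F.filter (fun nn => nn.2 = n₂))
      (t := {n ∈ Finset.Ioc ⌊(0 : ℝ)⌋₊ ⌊(0 : ℝ) + N⌋₊ | n ≡ c [MOD r] ∧ n ∈ Nat.smoothNumbers (y + 1)})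
      (fun nn hnn => ?_) (fun nn₁ hnn₁ nn₂ hnn₂ heq => ?_)
    · exact_mod_cast hinj
    · rw [Finset.mem_coe, Finset.mem_filter, hF, Finset.mem_filter, Finset.mem_product] at hnn
      obtain ⟨⟨⟨hn₁S, -⟩, hmod⟩, hn₂eq⟩ := hnn
      rw [hS, Nat.mem_smoothNumbersUpTo] at hn₁S
      rw [Finset.mem_coe, Finset.mem_filter, Finset.mem_Ioc, Nat.floor_zero, zero_add]
      refine ⟨⟨Nat.pos_of_ne_zero hn₁S.2.1, hn₁S.1⟩, ?_, hn₁S.2⟩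
      rw [← Int.natCast_modEq_iff, Int.ModEq, hcz, Int.emod_emod_of_dvd _ (dvd_refl _)]
      rw [hn₂eq] at hmod
      calc (nn.1 : ℤ) % r = (((nn.1 : ℤ) - n₂) + n₂) % r := by ring_nf
        _ = ((((nn.1 : ℤ) - n₂) % r) + n₂ % r) % r := Int.add_emod _ _ _
        _ = ((b % r) + n₂ % r) % r := by rw [hmod]
        _ = ((n₂ : ℤ) + b) % r := by rw [← Int.add_emod, add_comm]
    · have h1 := (Finset.mem_filter.mp (Finset.mem_coe.mp hnn₁)).2
      have h2 := (Finset.mem_filter.mp (Finset.mem_coe.mp hnn₂)).2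
      exact Prod.ext heq (by rw [h1, h2])
  calc ∑ n₂ ∈ S, ((F.filter (fun nn => nn.2 = n₂)).card : ℝ) ≤ ∑ n₂ ∈ S, Bd := Finset.sum_le_sum hrow
    _ = S.card * Bd := by rw [Finset.sum_const, nsmul_eq_mul]

/-! ### The diagonal sums -/

/-- The diagonal weight `min{2U, 1/(2|n₁−n₂||δ|)}` (`= 2U` when `n₁ = n₂` or `δ = 0`).
[cite: Harper2016, §3 (the terms `min{2^{j+1}qLy/p, 1/(|n₁−n₂| p δ)}`)] -/
def diagWeight (U δ : ℝ) (n₁ n₂ : ℕ) : ℝ :=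
  if n₁ = n₂ ∨ δ = 0 then 2 * U else min (2 * U) (1 / (2 * |(n₁ : ℝ) - n₂| * |δ|))

/-- `diagWeight ≤ 2U`. [folklore] -/
theorem diagWeight_le_two_mul (U δ : ℝ) (n₁ n₂ : ℕ) : diagWeight U δ n₁ n₂ ≤ 2 * U := by
  unfold diagWeight; split_ifs
  · exact le_rfl
  · exact min_le_left _ _

/-- `diagWeight ≥ 0` for `U ≥ 0`. [folklore] -/
theorem diagWeight_nonneg {U δ : ℝ} (hU : 0 ≤ U) (n₁ n₂ : ℕ) : 0 ≤ diagWeight U δ n₁ n₂ := by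
  unfold diagWeight; split_ifs
  · positivity
  · exact le_min (by positivity) (by positivity)

/-- `diagWeight ≤ 1/(2|n₁−n₂||δ|)` off the diagonal. [folklore] -/
theorem diagWeight_le_inv {U δ : ℝ} {n₁ n₂ : ℕ} (hne : n₁ ≠ n₂) (hδ : δ ≠ 0) :
    diagWeight U δ n₁ n₂ ≤ 1 / (2 * |(n₁ : ℝ) - n₂| * |δ|) := by
  unfold diagWeight
  rw [if_neg (by tauto)]
  exact min_le_right _ _

/-- `2^{clog₂ k} < 2k` for `k ≥ 1`. [folklore] -/
theorem two_pow_clog_lt {k : ℕ} (hk : 1 ≤ k) : 2 ^ Nat.clog 2 k < 2 * k := by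
  rcases eq_or_lt_of_le hk with h | h
  · subst h; simp
  · have := Nat.pow_pred_clog_lt_self one_lt_two h
    rw [Nat.pred_eq_sub_one] at this
    have hc : 1 ≤ Nat.clog 2 k := Nat.clog_pos one_lt_two h
    calc 2 ^ Nat.clog 2 k = 2 * 2 ^ (Nat.clog 2 k - 1) := by
          rw [← pow_succ']; congr 1; omega
      _ < 2 * k := by linarith

set_option maxHeartbeats 1600000 in
-- long assembly
/-- **The diagonal sums** (Harper's Proposition 1, second part, both cases `|δ| ≤ 1/x` and
`|δ| > 1/x` at once). For `x ≥ x₀`, `(log x)^4 ≤ y`, `log y ≤ (log x)^{1/6}`, `r ≥ 1`, `U ≥ 16`,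
`N = x/U`, `L = 2(1 + |δ| x)` with `r y L ≤ 2N`, and `S = S(y) ∩ [1, N]`:
`∑_{(n₁,n₂) ∈ S², r ∣ n₁−n₂} min{2U, 1/(2|n₁−n₂||δ|)} ≤ C (1 + log L) U · #S · log y · y^{1−α} (N/(Lr))^α ζ̃`
(dyadic ranges `2^{i−1} N/L < |n₁ − n₂| ≤ 2^i N/L`, on which the weight is `≤ 8U/2^i`, and the
segment bound `card_smooth_segment_modEq_le` around each `n₂`).
[cite: Harper2016, §3, Proposition 1 (second and third bounds) and its proof] -/
theorem sum_diagWeight_le :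
    ∃ C x₀ : ℝ, 0 < C ∧ ∀ (x : ℝ) (y : ℕ), x₀ ≤ x → Real.log x ^ 4 ≤ y →
      Real.log y ≤ Real.log x ^ (1 / 6 : ℝ) → ∀ (r : ℕ), 0 < r → ∀ (U δ : ℝ), 16 ≤ U →
      (r : ℝ) * y * (2 * (1 + |δ| * x)) ≤ 2 * (x / U) →
        ∑ nn ∈ ((Nat.smoothNumbersUpTo ⌊x / U⌋₊ (y + 1)) ×ˢ (Nat.smoothNumbersUpTo ⌊x / U⌋₊ (y + 1))).filter
            (fun nn => (r : ℤ) ∣ ((nn.1 : ℤ) - nn.2)), diagWeight U δ nn.1 nn.2 ≤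
          C * (1 + Real.log (2 * (1 + |δ| * x))) * U * (Nat.smoothNumbersUpTo ⌊x / U⌋₊ (y + 1)).card *
            (Real.log y * (y : ℝ) ^ (1 - saddlePoint x y) *
              ((x / U) / ((2 * (1 + |δ| * x)) * r)) ^ saddlePoint x y *
              (smoothZeta (saddlePoint x y) y / Real.sqrt (saddlePhi₂ (saddlePoint x y) y))) := by
  classical
  obtain ⟨C, x₀, hC, hseg⟩ := card_smooth_segment_modEq_le
  obtain ⟨x₀T, h35⟩ := three_fifths_le_saddlePoint
  obtain ⟨x₀1, hlt1⟩ := saddlePoint_lt_one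
  refine ⟨72 * C, max (max (max x₀ x₀T) x₀1) (Real.exp 16), by positivity,
    fun x y hx hy4 hy6 r hr U δ hU hryL => ?_⟩
  have hx₀ : x₀ ≤ x := le_trans (((le_max_left _ _).trans (le_max_left _ _)).trans (le_max_left _ _)) hx
  have hx₀T : x₀T ≤ x := le_trans (((le_max_right _ _).trans (le_max_left _ _)).trans (le_max_left _ _)) hx
  have hx₀1 : x₀1 ≤ x := le_trans ((le_max_right _ _).trans (le_max_left _ _)) hx
  have hL16 : (16 : ℝ) ≤ Real.log x := by
    have := Real.log_le_log (Real.exp_pos _) (le_trans (le_max_right _ _) hx)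
    rwa [Real.log_exp] at this
  have hx16 : (16 : ℝ) ≤ x := by
    have h1 : (16 : ℝ) ≤ Real.exp 16 := by have := Real.add_one_le_exp (16 : ℝ); linarith
    exact h1.trans (le_trans (le_max_right _ _) hx)
  have hx1 : 1 < x := by linarith
  have hx0 : 0 < x := by linarith
  have hlogx1 : 1 ≤ Real.log x := by linarith
  have hyL : Real.log x ≤ y := by
    calc Real.log x = Real.log x ^ 1 := (pow_one _).symm
      _ ≤ Real.log x ^ 4 := pow_le_pow_right₀ hlogx1 (by norm_num)
      _ ≤ y := hy4
  have hy2r : (2 : ℝ) ≤ y := by linarith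
  have hy0 : (0 : ℝ) < y := by linarith
  have hy1 : (1 : ℝ) ≤ y := by linarith
  have hℓ0 : 0 < Real.log y := Real.log_pos (by linarith)
  have hyx : (y : ℝ) ≤ x := by
    have h6 : Real.log y ≤ Real.log x := by
      refine hy6.trans ?_
      calc Real.log x ^ (1 / 6 : ℝ) ≤ Real.log x ^ (1 : ℝ) :=
            Real.rpow_le_rpow_of_exponent_le hlogx1 (by norm_num)
        _ = Real.log x := Real.rpow_one _
    rw [← Real.exp_log hy0, ← Real.exp_log hx0]; exact Real.exp_le_exp.mpr h6
  have hy3 : Real.log x ^ 3 ≤ y := le_trans (pow_le_pow_right₀ hlogx1 (by norm_num)) hy4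
  set α := saddlePoint x y with hαdef
  have hα35 : 3 / 5 ≤ α := h35 x y hx₀T hy3 hyx
  have hα0 : 0 < α := by linarith
  have hα1 : α ≤ 1 := (hlt1 x y hx₀1 hy3 hyx hy6).le
  set ζt := smoothZeta α y / Real.sqrt (saddlePhi₂ α y) with hζt
  have hζt0 : 0 ≤ ζt := div_nonneg (smoothZeta_pos hα0).le (Real.sqrt_nonneg _)
  ------------------------------------------------------------------
  -- parameters
  set L := 2 * (1 + |δ| * x) with hL
  have hδx0 : 0 ≤ |δ| * x := by positivity
  have hL2 : 2 ≤ L := by rw [hL]; linarith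
  have hL0 : 0 < L := by linarith
  have hU0 : 0 < U := by linarith
  set N := x / U with hN
  have hN0 : 0 < N := by positivity
  have hN16 : 16 * N ≤ x := by
    rw [hN]; rw [mul_div_assoc']; rw [div_le_iff₀ hU0]; nlinarith
  set D := N / L with hD
  have hD0 : 0 < D := by positivity
  have hDL : D * L = N := by rw [hD]; field_simp
  have hr0 : (0 : ℝ) < r := by exact_mod_cast hr
  have hry2D : (r : ℝ) * y ≤ 2 * D := by
    rw [hD, mul_div_assoc', le_div_iff₀ hL0]; linarith
  have hD1 : 1 ≤ D := by
    have : (1 : ℝ) * 2 ≤ r * y := by nlinarith [show (1 : ℝ) ≤ r by exact_mod_cast hr]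
    linarith
  set S := Nat.smoothNumbersUpTo ⌊N⌋₊ (y + 1) with hS
  have hSmem : ∀ n ∈ S, 1 ≤ n ∧ (n : ℝ) ≤ N ∧ n ∈ Nat.smoothNumbers (y + 1) := by
    intro n hn
    rw [hS, Nat.mem_smoothNumbersUpTo] at hn
    exact ⟨Nat.pos_of_ne_zero hn.2.1, le_trans (by exact_mod_cast hn.1) (Nat.floor_le hN0.le), hn.2⟩
  set F := (S ×ˢ S).filter (fun nn => (r : ℤ) ∣ ((nn.1 : ℤ) - nn.2)) with hF
  -- block index
  set g : ℕ × ℕ → ℕ := fun nn => Nat.clog 2 ⌈|(nn.1 : ℝ) - nn.2| / D⌉₊ with hg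
  set I : ℕ := Nat.clog 2 ⌈L⌉₊ with hI
  have hFmem : ∀ nn ∈ F, nn.1 ∈ S ∧ nn.2 ∈ S ∧ (r : ℤ) ∣ ((nn.1 : ℤ) - nn.2) := by
    intro nn hnn
    rw [hF, Finset.mem_filter, Finset.mem_product] at hnn
    exact ⟨hnn.1.1, hnn.1.2, hnn.2⟩
  have hdist : ∀ nn ∈ F, |(nn.1 : ℝ) - nn.2| < N := by
    intro nn hnn
    obtain ⟨h1, h2, -⟩ := hFmem nn hnn
    obtain ⟨h11, h1N, -⟩ := hSmem _ h1
    obtain ⟨h21, h2N, -⟩ := hSmem _ h2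
    have h11' : (1 : ℝ) ≤ nn.1 := by exact_mod_cast h11
    have h21' : (1 : ℝ) ≤ nn.2 := by exact_mod_cast h21
    rw [abs_lt]; constructor <;> linarith
  have hgI : ∀ nn ∈ F, g nn ∈ Finset.range (I + 1) := by
    intro nn hnn
    rw [Finset.mem_range, Nat.lt_succ_iff, hg, hI]
    apply Nat.clog_mono_right
    apply Nat.ceil_mono
    rw [div_le_iff₀ hD0, mul_comm, hDL]
    exact (hdist nn hnn).le
  -- `d ≤ 2^{g} D`
  have hd_le : ∀ nn : ℕ × ℕ, |(nn.1 : ℝ) - nn.2| ≤ 2 ^ (g nn) * D := by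
    intro nn
    have h1 : |(nn.1 : ℝ) - nn.2| / D ≤ ⌈|(nn.1 : ℝ) - nn.2| / D⌉₊ := Nat.le_ceil _
    have h2 : (⌈|(nn.1 : ℝ) - nn.2| / D⌉₊ : ℝ) ≤ 2 ^ (g nn) := by
      rw [hg]; exact_mod_cast Nat.le_pow_clog one_lt_two _
    rw [div_le_iff₀ hD0] at h1
    calc |(nn.1 : ℝ) - nn.2| ≤ ⌈|(nn.1 : ℝ) - nn.2| / D⌉₊ * D := h1
      _ ≤ 2 ^ (g nn) * D := by gcongr
  -- `d > 2^{g-1} D` when `g ≥ 1`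
  have hd_gt : ∀ nn : ℕ × ℕ, 1 ≤ g nn → 2 ^ (g nn - 1) * D < |(nn.1 : ℝ) - nn.2| := by
    intro nn hg1
    set k := ⌈|(nn.1 : ℝ) - nn.2| / D⌉₊ with hk
    have hk2 : 2 ^ (g nn - 1) < k := by
      by_contra hcon
      push Not at hcon
      have := Nat.clog_mono_right 2 hcon
      rw [Nat.clog_pow _ _ one_lt_two] at this
      have : g nn ≤ g nn - 1 := this
      omega
    have hk1 : (k : ℝ) < |(nn.1 : ℝ) - nn.2| / D + 1 := Nat.ceil_lt_add_one (by positivity)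
    have hk2' : (2 : ℝ) ^ (g nn - 1) + 1 ≤ k := by exact_mod_cast hk2
    have : (2 : ℝ) ^ (g nn - 1) < |(nn.1 : ℝ) - nn.2| / D := by linarith
    rwa [lt_div_iff₀ hD0] at this
  -- `2^I < 2 ⌈L⌉ ≤ 3 L`, hence `2^i D ≤ 4N` for `i ≤ I` and `I + 1 ≤ 3 (1 + log L)`
  have hL1 : 1 ≤ ⌈L⌉₊ := Nat.one_le_iff_ne_zero.mpr (Nat.ceil_pos.mpr hL0).ne'
  have h2I : (2 : ℝ) ^ I < 2 * ⌈L⌉₊ := by rw [hI]; exact_mod_cast two_pow_clog_lt hL1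
  have hceilL : (⌈L⌉₊ : ℝ) < L + 1 := Nat.ceil_lt_add_one hL0.le
  have h2I' : (2 : ℝ) ^ I ≤ 3 * L := by linarith
  have hIlog : (I : ℝ) + 1 ≤ 3 * (1 + Real.log L) := by
    have h1 : (I : ℝ) * Real.log 2 ≤ Real.log (3 * L) := by
      rw [← Real.log_pow]; exact Real.log_le_log (by positivity) (by exact_mod_cast h2I')
    rw [Real.log_mul (by norm_num) hL0.ne'] at h1
    have h3 : Real.log 3 ≤ 2 * Real.log 2 := by
      have : Real.log 3 ≤ Real.log (2 ^ 2) := Real.log_le_log (by norm_num) (by norm_num)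
      rwa [Real.log_pow, Nat.cast_ofNat] at this
    have hl2 : (0.6931471803 : ℝ) < Real.log 2 := Real.log_two_gt_d9
    have hlogL : 0 ≤ Real.log L := Real.log_nonneg (by linarith)
    have key : ((I : ℝ) + 1) * Real.log 2 ≤ (3 * (1 + Real.log L)) * Real.log 2 := by nlinarith
    exact le_of_mul_le_mul_right key (by linarith)
  ------------------------------------------------------------------
  -- the weight on block `i` is `≤ 8U/2^i`
  have hweight : ∀ nn ∈ F, diagWeight U δ nn.1 nn.2 ≤ 8 * U / 2 ^ (g nn) := by
    intro nn hnn
    have hi := hgI nn hnn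
    rw [Finset.mem_range, Nat.lt_succ_iff] at hi
    rcases le_or_gt (g nn) 2 with h2 | h2
    · -- `i ≤ 2`: trivial bound
      calc diagWeight U δ nn.1 nn.2 ≤ 2 * U := diagWeight_le_two_mul U δ _ _
        _ = 8 * U / 2 ^ 2 := by ring
        _ ≤ 8 * U / 2 ^ (g nn) := by
            apply div_le_div_of_nonneg_left (by positivity) (by positivity)
            exact pow_le_pow_right₀ (by norm_num) h2
    · -- `i ≥ 3`: then `L > 4`, `|δ| x > 1`, `δ ≠ 0`, `n₁ ≠ n₂`
      have hI3 : 3 ≤ I := le_trans h2 hi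
      have hL4 : 4 < L := by
        by_contra hcon; push Not at hcon
        have : ⌈L⌉₊ ≤ 4 := Nat.ceil_le.mpr (by exact_mod_cast hcon)
        have := Nat.clog_mono_right 2 this
        rw [show (4 : ℕ) = 2 ^ 2 by norm_num, Nat.clog_pow _ _ one_lt_two] at this
        rw [hI] at hI3; omega
      have hδx1 : 1 < |δ| * x := by rw [hL] at hL4; linarith
      have hδ0 : δ ≠ 0 := by
        intro h0; rw [h0, abs_zero, zero_mul] at hδx1; linarith
      have hδpos : 0 < |δ| := abs_pos.mpr hδ0
      have hdpos : 0 < |(nn.1 : ℝ) - nn.2| :=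
        lt_of_le_of_lt (by positivity) (hd_gt nn (by omega))
      have hne : nn.1 ≠ nn.2 := by
        intro h; rw [h, sub_self, abs_zero] at hdpos; exact lt_irrefl _ hdpos
      have hlow := hd_gt nn (by omega)
      -- `L ≤ 4 |δ| x`
      have hL4δ : L ≤ 4 * (|δ| * x) := by rw [hL]; linarith
      calc diagWeight U δ nn.1 nn.2 ≤ 1 / (2 * |(nn.1 : ℝ) - nn.2| * |δ|) := diagWeight_le_inv hne hδ0
        _ ≤ 1 / (2 * (2 ^ (g nn - 1) * D) * |δ|) := by
            apply one_div_le_one_div_of_le (by positivity)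
            gcongr
        _ = 1 / (2 ^ (g nn) * D * |δ|) := by
            congr 1
            have : (2 : ℝ) ^ (g nn) = 2 * 2 ^ (g nn - 1) := by
              rw [← pow_succ']; congr 1; omega
            rw [this]; ring
        _ = L * U / (2 ^ (g nn) * (x * |δ|)) := by
            rw [hD, hN]; field_simp
        _ ≤ 4 * (|δ| * x) * U / (2 ^ (g nn) * (x * |δ|)) := by
            apply div_le_div_of_nonneg_right _ (by positivity)
            exact mul_le_mul_of_nonneg_right hL4δ hU0.le
        _ = 4 * U / 2 ^ (g nn) := by field_simp
        _ ≤ 8 * U / 2 ^ (g nn) := by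
            apply div_le_div_of_nonneg_right _ (by positivity); linarith
  ------------------------------------------------------------------
  -- the count on block `i`
  set seg : ℕ → ℝ := fun i => C * Real.log y * ((2 ^ (i + 1) * D + 1) / r) ^ α * (y : ℝ) ^ (1 - α) * ζt
    with hsegdef
  have hcount : ∀ i ∈ Finset.range (I + 1),
      ((F.filter (fun nn => g nn = i)).card : ℝ) ≤ S.card * seg i := by
    intro i hi
    rw [Finset.mem_range, Nat.lt_succ_iff] at hi
    have h2i : (2 : ℝ) ^ i ≤ 3 * L := le_trans (pow_le_pow_right₀ (by norm_num) hi) h2I'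
    set Fi := F.filter (fun nn => g nn = i) with hFi
    have hmaps : ∀ nn ∈ Fi, nn.2 ∈ S := fun nn hnn =>
      (hFmem nn (Finset.mem_filter.mp hnn).1).2.1
    rw [Finset.card_eq_sum_card_fiberwise hmaps]
    push_cast
    have hrow : ∀ n₂ ∈ S, ((Fi.filter (fun nn => nn.2 = n₂)).card : ℝ) ≤ seg i := by
      intro n₂ hn₂
      obtain ⟨-, hn₂N, -⟩ := hSmem n₂ hn₂
      set V : ℝ := max 0 ((n₂ : ℝ) - 2 ^ i * D - 1) with hV
      set Z : ℝ := 2 ^ (i + 1) * D + 1 with hZ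
      have hV0 : 0 ≤ V := le_max_left _ _
      have hryZ : (r : ℝ) * y ≤ Z := by
        rw [hZ, pow_succ]
        have : (1 : ℝ) ≤ 2 ^ i := one_le_pow₀ (by norm_num)
        nlinarith
      have hVZ : V + Z ≤ x := by
        have h1 : V ≤ max 0 ((n₂ : ℝ) - 2 ^ i * D - 1) := le_rfl
        have h2 : (2 : ℝ) ^ (i + 1) * D ≤ 6 * N := by
          rw [pow_succ]
          calc (2 : ℝ) ^ i * 2 * D = 2 * (2 ^ i * D) := by ring
            _ ≤ 2 * (3 * L * D) := by gcongr
            _ = 6 * N := by rw [← hDL]; ring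
        have h3 : V ≤ N := by
          rw [hV]; apply max_le hN0.le
          have : (0 : ℝ) ≤ 2 ^ i * D := by positivity
          linarith
        rw [hZ]; linarith
      have key := hseg x y hx₀ hy4 hy6 r hr (n₂ % r) V Z hV0 hryZ hVZ
      rw [← hαdef] at key
      refine le_trans ?_ (le_of_le_of_eq key (by rw [hsegdef, hζt]))
      have hinj := Finset.card_le_card_of_injOn (fun nn : ℕ × ℕ => nn.1)
        (s := Fi.filter (fun nn => nn.2 = n₂))
        (t := {n ∈ Finset.Ioc ⌊V⌋₊ ⌊V + Z⌋₊ | n ≡ n₂ % r [MOD r] ∧ n ∈ Nat.smoothNumbers (y + 1)})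
        (fun nn hnn => ?_) (fun nn₁ hnn₁ nn₂ hnn₂ heq => ?_)
      · exact_mod_cast hinj
      · rw [Finset.mem_coe, Finset.mem_filter, hFi, Finset.mem_filter] at hnn
        obtain ⟨⟨hnnF, hgi⟩, hn₂eq⟩ := hnn
        obtain ⟨hn₁S, -, hdvd⟩ := hFmem nn hnnF
        obtain ⟨hn₁1, -, hn₁sm⟩ := hSmem _ hn₁S
        have hdle := hd_le nn
        rw [hgi, hn₂eq] at hdle
        rw [hn₂eq] at hdvd
        have habs := abs_le.mp hdle
        rw [Finset.mem_coe, Finset.mem_filter, Finset.mem_Ioc]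
        refine ⟨⟨?_, ?_⟩, ?_, hn₁sm⟩
        · rw [Nat.floor_lt hV0, hV]
          apply max_lt
          · exact_mod_cast hn₁1
          · linarith [habs.1]
        · apply Nat.le_floor
          have : (n₂ : ℝ) + 2 ^ i * D ≤ V + Z := by
            rw [hV, hZ, pow_succ]
            have := le_max_right (0 : ℝ) ((n₂ : ℝ) - 2 ^ i * D - 1)
            linarith
          linarith [habs.2]
        · have h1 : (nn.1 : ℤ) ≡ n₂ [ZMOD r] := (Int.modEq_iff_dvd.mpr (by
              obtain ⟨k, hk⟩ := hdvd; exact ⟨-k, by linarith⟩))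
          have h2 : nn.1 ≡ n₂ [MOD r] := Int.natCast_modEq_iff.mp h1
          exact h2.trans (Nat.mod_modEq n₂ r).symm
      · have h1 := (Finset.mem_filter.mp (Finset.mem_coe.mp hnn₁)).2
        have h2 := (Finset.mem_filter.mp (Finset.mem_coe.mp hnn₂)).2
        exact Prod.ext heq (by rw [h1, h2])
    calc ∑ n₂ ∈ S, ((Fi.filter (fun nn => nn.2 = n₂)).card : ℝ) ≤ ∑ n₂ ∈ S, seg i :=
          Finset.sum_le_sum hrow
      _ = S.card * seg i := by rw [Finset.sum_const, nsmul_eq_mul]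
  ------------------------------------------------------------------
  -- `seg i ≤ 3 · 2^{iα} · C log y (D/r)^α y^{1-α} ζt`
  have hseg_le : ∀ i : ℕ, seg i ≤ 3 * (2 : ℝ) ^ ((i : ℝ) * α) *
      (C * Real.log y * (D / r) ^ α * (y : ℝ) ^ (1 - α) * ζt) := by
    intro i
    have h1 : ((2 : ℝ) ^ (i + 1) * D + 1) / r ≤ 3 * 2 ^ i * (D / r) := by
      rw [div_le_iff₀ hr0, pow_succ]
      have : (1 : ℝ) ≤ 2 ^ i * D := by
        have := one_le_pow₀ (M₀ := ℝ) (a := 2) (n := i) (by norm_num); nlinarith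
      have : 3 * 2 ^ i * (D / r) * r = 3 * (2 ^ i * D) := by field_simp
      linarith
    have h2 : (((2 : ℝ) ^ (i + 1) * D + 1) / r) ^ α ≤ (3 * 2 ^ i * (D / r)) ^ α :=
      Real.rpow_le_rpow (by positivity) h1 hα0.le
    have h3 : (3 * (2 : ℝ) ^ i * (D / r)) ^ α ≤ 3 * 2 ^ ((i : ℝ) * α) * (D / r) ^ α := by
      rw [Real.mul_rpow (by positivity) (by positivity), Real.mul_rpow (by norm_num) (by positivity)]
      have h31 : (3 : ℝ) ^ α ≤ 3 := by
        calc (3 : ℝ) ^ α ≤ 3 ^ (1 : ℝ) := Real.rpow_le_rpow_of_exponent_le (by norm_num) hα1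
          _ = 3 := Real.rpow_one 3
      have h32 : ((2 : ℝ) ^ i) ^ α = 2 ^ ((i : ℝ) * α) := by
        rw [← Real.rpow_natCast, ← Real.rpow_mul (by norm_num)]
      rw [h32]
      gcongr
    calc seg i = C * Real.log y * (((2 : ℝ) ^ (i + 1) * D + 1) / r) ^ α * (y : ℝ) ^ (1 - α) * ζt := by
          rw [hsegdef]
      _ ≤ C * Real.log y * (3 * 2 ^ ((i : ℝ) * α) * (D / r) ^ α) * (y : ℝ) ^ (1 - α) * ζt := by
          gcongr
          exact h2.trans h3
      _ = _ := by ring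
  ------------------------------------------------------------------
  -- assemble
  rw [← Finset.sum_fiberwise_of_maps_to hgI]
  have hblock : ∀ i ∈ Finset.range (I + 1),
      ∑ nn ∈ F.filter (fun nn => g nn = i), diagWeight U δ nn.1 nn.2 ≤
        24 * U * S.card * (C * Real.log y * (D / r) ^ α * (y : ℝ) ^ (1 - α) * ζt) := by
    intro i hi
    have hw : ∀ nn ∈ F.filter (fun nn => g nn = i), diagWeight U δ nn.1 nn.2 ≤ 8 * U / 2 ^ i := by
      intro nn hnn
      rw [Finset.mem_filter] at hnn
      have := hweight nn hnn.1
      rwa [hnn.2] at this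
    set K := C * Real.log y * (D / r) ^ α * (y : ℝ) ^ (1 - α) * ζt with hK
    have hK0 : 0 ≤ K := by positivity
    have hpow : (8 * U / 2 ^ i) * (3 * (2 : ℝ) ^ ((i : ℝ) * α)) ≤ 24 * U := by
      have h1 : (2 : ℝ) ^ ((i : ℝ) * α) ≤ 2 ^ i := by
        calc (2 : ℝ) ^ ((i : ℝ) * α) ≤ 2 ^ ((i : ℝ) * 1) :=
              Real.rpow_le_rpow_of_exponent_le (by norm_num) (by nlinarith [(Nat.cast_nonneg i : (0:ℝ) ≤ i)])
          _ = 2 ^ i := by rw [mul_one, Real.rpow_natCast]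
      have h2i : (0 : ℝ) < 2 ^ i := by positivity
      calc (8 * U / 2 ^ i) * (3 * (2 : ℝ) ^ ((i : ℝ) * α)) ≤ (8 * U / 2 ^ i) * (3 * 2 ^ i) := by
            gcongr
        _ = 24 * U := by field_simp; ring
    calc ∑ nn ∈ F.filter (fun nn => g nn = i), diagWeight U δ nn.1 nn.2
        ≤ ∑ nn ∈ F.filter (fun nn => g nn = i), 8 * U / 2 ^ i := Finset.sum_le_sum hw
      _ = (F.filter (fun nn => g nn = i)).card * (8 * U / 2 ^ i) := by
          rw [Finset.sum_const, nsmul_eq_mul]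
      _ ≤ (S.card * seg i) * (8 * U / 2 ^ i) :=
          mul_le_mul_of_nonneg_right (hcount i hi) (by positivity)
      _ ≤ (S.card * (3 * (2 : ℝ) ^ ((i : ℝ) * α) * K)) * (8 * U / 2 ^ i) := by
          gcongr; exact hseg_le i
      _ = ((8 * U / 2 ^ i) * (3 * (2 : ℝ) ^ ((i : ℝ) * α))) * (S.card * K) := by ring
      _ ≤ (24 * U) * (S.card * K) := mul_le_mul_of_nonneg_right hpow (by positivity)
      _ = 24 * U * S.card * K := by ring
  calc ∑ i ∈ Finset.range (I + 1), ∑ nn ∈ F.filter (fun nn => g nn = i), diagWeight U δ nn.1 nn.2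
      ≤ ∑ i ∈ Finset.range (I + 1), 24 * U * S.card * (C * Real.log y * (D / r) ^ α * (y : ℝ) ^ (1 - α) * ζt) :=
        Finset.sum_le_sum hblock
    _ = ((I : ℝ) + 1) * (24 * U * S.card * (C * Real.log y * (D / r) ^ α * (y : ℝ) ^ (1 - α) * ζt)) := by
        rw [Finset.sum_const, Finset.card_range, nsmul_eq_mul]; push_cast; ring
    _ ≤ (3 * (1 + Real.log L)) * (24 * U * S.card * (C * Real.log y * (D / r) ^ α * (y : ℝ) ^ (1 - α) * ζt)) :=
        mul_le_mul_of_nonneg_right hIlog (by positivity)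
    _ = 72 * C * (1 + Real.log L) * U * S.card * (Real.log y * (y : ℝ) ^ (1 - α) * (D / r) ^ α * ζt) := by
        ring
    _ = _ := by rw [hD, hζt, div_div]

end Literature.NumberTheory.Sieve

end
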